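import Mathlib
import HarnessLib
import Summits.HubbardSuperconductivity.HubbardSuperconductivity.Theorems.KLProgrammeKLRegimeEngineV17F2OfRows
import Summits.HubbardSuperconductivity.HubbardSuperconductivity.Theorems.KLProgrammeKLRegimeVolumeLimitHOscOfEngineOsc

/-!
# Route `KLProgramme` — ENGINE item stmt-HubbardSuperconductivity-20437 `KLRegimeEngineV17F2`, registration r16 V2 (α1) «A24∪A25∪Z∪α1»-G14
# (image 27cd7ed0f55f17c0): THE ENG-OSC SEAM AND THE VL (K5′) ATOM FROM THE FIVE REGISTERED ROWS, BY NAME (cell gate-hubbard-kl, seat p2 g27)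

WHAT.  p1b g18's `R16V2Rows.KLRegimeEngineV17F2_of_rows` (…EngineV17F2OfRows, p712565) put the image's §C composition in the tree as a CONDITIONAL theorem of the
five ACTIVE rows (hypothesis digests rowC 7138417578ff · rowX b5ef244eede8 · rowB e78dfb33d2f7 · rowV f2bba37a7dce · rowE d9e0dae239cf), exporting
`engine_slots_of_rows` and `flowPieceOsc_hist_of_rows`.  The VOLUME-LIMIT crux stmt-HubbardSuperconductivity-23356 consumes the engine through ONE seam, ENG-OSC
(text d8a343f5c828: engine ∧ two-leg slots ∧ the (K5′) flow-piece oscillation export below the horizon), via p2's door `hoscTAtom_of_engineOsc : ENG-OSC → <VL atom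
stub_vl_flowPieceOscTE 398b3e3a086b>` (…VolumeLimitHOscOfEngineOsc).  Until today ENG-OSC existed only as the image-level corollary `engineP4Osc_klPredsV17F2_of_stubs_v2x`
(sorried stubs; HOME/p2-g25/r16b/, unfiled by design).  This file is its OF-ROWS form, landable now:
* **`engineP4Osc_klPredsV17F2_of_rows rowC rowX rowB rowV rowE : ENG-OSC`** — witnesses `G := klEngGeo14`, `Q := klEngQ9dG klEngGeo14 P R`, `c₃ := klEngC₃7GU …`,
  `c″ := klReadOscC P R`, `U₀ := klEngU₀12GQ …`, `L₃ := klEngL₄ P R`, `M₃ := klEngM₃`; slots by `engine_slots_of_rows`, the oscillation export by `flowPieceOsc_hist_of_rows`;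
* **`vlFlowPieceOscTE_of_rows rowC rowX rowB rowV rowE : <the VL atom `stub_vl_flowPieceOscTE` text>`** `:= hoscTAtom_of_engineOsc (engineP4Osc_… rows)`.
So the (K5′) atom of VL 23356 is, BY NAME, a consequence of the five registered engine rows — the one-application endgame text for that seam.
Pure composition of landed theorems (no definition, no instance, no notation); CONDITIONAL: the five rows are HYPOTHESES (OPEN; owners per CLOSING-MAP-r16V2);
nothing here asserts any row, ENG-OSC, the VL atom, VL, K3, the Kohn–Luttinger margin or superconductivity in the Hubbard model.  0 kit · 0 lit.
References: BGM 2006 §2.4 (2.36)–(2.42), §3 (the engine step and the counterterm flow these rows formalise) [cite: BenfattoGiulianiMastropietro2006].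
-/

noncomputable section

namespace Summit.HubbardSuperconductivity.HubbardSuperconductivity.Theorems.EngineV8.R16V2Rows

set_option linter.dupNamespace false -- summit = problem name (single-conjunct summit), D-0017

open Real Finset Filter Literature.MathematicalPhysics.QuantumLattice Literature.Probability.LatticeModels
open Literature.MathematicalPhysics.QuantumLattice.FermiRG
open Summit.HubbardSuperconductivity.HubbardSuperconductivity.Theorems.KLProgrammeLegKernels
open Summit.HubbardSuperconductivity.HubbardSuperconductivity.Theorems.DispersionFlow
open Summit.HubbardSuperconductivity.HubbardSuperconductivity.Theorems.KLRegimeSplit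

set_option maxRecDepth 8192 in
set_option maxHeartbeats 3200000 in -- long binder lists
/-- **ENG-OSC FROM THE FIVE REGISTERED ROWS** (seam text d8a343f5c828; consumer `hoscTAtom_of_engineOsc` / `hoscAtom_of_children`). [cite: BenfattoGiulianiMastropietro2006, §2.4 (2.36)–(2.42)] -/
theorem engineP4Osc_klPredsV17F2_of_rows
    (rowC :
      ∀ (P : SplitConsts) (R : RenConsts) (c : ℝ), P.WF → R.WF2 → 0 < c → c ≤ klEngC₃7GU klEngGeo14 P R →
      ∀ μ ∈ klWindowC, ∀ U : ℝ, 0 < U → U ≤ klEngU₀12GQ klEngGeo14 (klEngQ9dG klEngGeo14 P R) P R c → ∀ β : ℝ, klBetaMin ≤ β → β ≤ Real.exp (c / U ^ 2) →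
      ∀ (L M : ℕ) [NeZero L] [NeZero M], klEngL₄ P R β U ≤ L → klEngM₃ β U L ≤ M → ∀ n : ℕ, n ≤ nScales β + 1 → IsKLRegime U c (-(n : ℤ)) →
      HistP klPredsV17F2 L M klEngGeo14 P (klEngQ9dG klEngGeo14 P R) R β U μ 0 n → FrameOK R U (nScales β) μ (klFlowFrameU L M β U μ n) →
      EngineBoundsAtV17F2 L M klEngGeo14 P (klEngQ9dG klEngGeo14 P R) β U μ n → TwoLegDualSpaceMomentsUpToAt L M (klZsp5AtZ P R (klEngQ7 P R) klEngGeo14 U n) β U μ n 5 →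
      TwoLegReadJetBound L M klC4aJetC2 (klC4aJetC' P R) β U μ (klFlowFrameU L M β U μ n) n ∧ TwoLegReadOscAt L M (klReadOscC P R) β U μ (klFlowFrameU L M β U μ n) n)
    (rowX :
      ∀ (P : SplitConsts) (R : RenConsts), P.WF → R.WF2 → (∃ e : (ℕ → ℝ) × ℝ × (EngConsts → ℝ → ℝ), IsExportPkg2 e ∧ LevelsUStep2 P R (klEngQ7 P R) e.1 e.2.2) ∧
      (∃ e : ℝ × (EngConsts → ℝ → ℝ), IsTransferPkg8 e ∧ PairTransferStep7 P R (klEngQ7 P R) klEngGeo14 klEngGeoTh e.1 e.2) ∧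
      (∃ e : (ℕ → ℝ) × (EngConsts → ℝ → ℝ), IsSpaceMomPkg5Z R e ∧ TwoLegSpaceMomentsStep5 P R (klEngQ7 P R) klEngGeo14 e.1 e.2))
    (rowB :
      ∀ (P : SplitConsts) (R : RenConsts) (c : ℝ), P.WF → R.WF2 → 0 < c → c ≤ klEngC₃7GU klEngGeo14 P R →
      ∀ μ ∈ klWindowC, ∀ U : ℝ, 0 < U → U ≤ klEngU₀12GQ klEngGeo14 (klEngQ9dG klEngGeo14 P R) P R c → ∀ β : ℝ, klBetaMin ≤ β → β ≤ Real.exp (c / U ^ 2) →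
      ∀ (L M : ℕ) [NeZero L] [NeZero M], klEngL₄ P R β U ≤ L → klEngM₃ β U L ≤ M → ∀ n : ℕ, 1 ≤ n → n ≤ nScales β + 1 → IsKLRegime U c (-(n : ℤ)) →
      HistP klPredsV17F2 L M klEngGeo14 P (klEngQ9dG klEngGeo14 P R) R β U μ 0 n → (∀ m, 1 ≤ m → m < n → FlowPieceOscAt L M (klReadOscC P R) β U μ m) →
      FrameOK R U (nScales β) μ (klFlowFrameU L M β U μ n) → (∀ j ≤ n, LevelsUExportMixedAt L M (klCU2 P R (klEngQ7 P R)) P β U μ j) →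
      KernelNormsV4 L M P (klEngQ9dG klEngGeo14 P R) β U μ (klFlowFrameU L M β U μ n) n ∧
      (∀ j ≤ n, (KernelNormsLevels L M P (klEngQ9dG klEngGeo14 P R) β U μ (klFlowFrameU L M β U μ n) j ∧
      KernelNormsWt4 L M (klWtBudget P (klEngQ9dG klEngGeo14 P R) U j) β U μ (klFlowFrameU L M β U μ n) j)) ∧
      EngineFirstMoments L M klEngGeo14 P (klEngQ9dG klEngGeo14 P R) β U μ (klFlowFrameU L M β U μ n) n ∧ IsoFirstMomentsAt L M klIsoMomC (klIsoMomD P R) P β U μ n ∧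
      TwoLegGridFlowMomentsAtC L M (klZtG klEngGeo14 P R) (klZs1G klEngGeo14 P R) (klZs2G klEngGeo14 P R) c β U μ n)
    (rowV :
      ∀ (P : SplitConsts) (R : RenConsts) (c : ℝ), P.WF → R.WF2 → 0 < c → c ≤ klEngC₃7GU klEngGeo14 P R →
      ∀ μ ∈ klWindowC, ∀ U : ℝ, 0 < U → U ≤ klEngU₀12GQ klEngGeo14 (klEngQ9dG klEngGeo14 P R) P R c → ∀ β : ℝ, klBetaMin ≤ β → β ≤ Real.exp (c / U ^ 2) →
      ∀ (L M : ℕ) [NeZero L] [NeZero M], klEngL₄ P R β U ≤ L → klEngM₃ β U L ≤ M → ∀ n : ℕ, 1 ≤ n → n ≤ nScales β + 1 → IsKLRegime U c (-(n : ℤ)) →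
      HistP klPredsV17F2 L M klEngGeo14 P (klEngQ9dG klEngGeo14 P R) R β U μ 0 n → FrameOK R U (nScales β) μ (klFlowFrameU L M β U μ n) →
      KernelNormsV4 L M P (klEngQ9dG klEngGeo14 P R) β U μ (klFlowFrameU L M β U μ n) n →
      (∀ j ≤ n, (KernelNormsLevels L M P (klEngQ9dG klEngGeo14 P R) β U μ (klFlowFrameU L M β U μ n) j ∧
      KernelNormsWt4 L M (klWtBudget P (klEngQ9dG klEngGeo14 P R) U j) β U μ (klFlowFrameU L M β U μ n) j)) →
      (∀ j ≤ n, LevelsUExportMixedAt L M (klCU2 P R (klEngQ7 P R)) P β U μ j) → (∀ j ≤ n, IsoTupleLineBAt L M klE5AM klE5cM (klE5dM P R) P β U μ j) →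
      (∀ j ≤ n, PairTransferRelFamilyK5 L M klEngGeoTh P (klCT8 P R (klEngQ7 P R) klEngGeo14 klEngGeoTh) β U μ j) →
      PairLadderStepAtV17F2 L M klEngGeo14 P (klEngQ9dG klEngGeo14 P R) β U μ n ∧ PairValueIncrementAtV17F L M klEngGeo14 P (klEngQ9dG klEngGeo14 P R) β U μ n ∧
      QuarticValueIncrementAtV17F L M klEngGeo14 P (klEngQ9dG klEngGeo14 P R) β U μ n ∧ IsoTupleL1AtV17F L M klEngGeo14 P β U μ n)
    (rowE :
      ∀ (P : SplitConsts) (R : RenConsts) (c : ℝ), P.WF → R.WF2 → 0 < c → c ≤ klEngC₃7GU klEngGeo14 P R →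
      ∀ μ ∈ klWindowC, ∀ U : ℝ, 0 < U → U ≤ klEngU₀12GQ klEngGeo14 (klEngQ9dG klEngGeo14 P R) P R c → ∀ β : ℝ, klBetaMin ≤ β → β ≤ Real.exp (c / U ^ 2) →
      ∀ (L M : ℕ) [NeZero L] [NeZero M], klEngL₄ P R β U ≤ L → klEngM₃ β U L ≤ M → ∀ n : ℕ, 1 ≤ n → n ≤ nScales β + 1 → IsKLRegime U c (-(n : ℤ)) →
      HistP klPredsV17F2 L M klEngGeo14 P (klEngQ9dG klEngGeo14 P R) R β U μ 0 n → FrameOK R U (nScales β) μ (klFlowFrameU L M β U μ n) →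
      EngineBoundsAtV17F2 L M klEngGeo14 P (klEngQ9dG klEngGeo14 P R) β U μ n → TwoLegReadJetBound L M klC4aJetC2 (klC4aJetC' P R) β U μ (klFlowFrameU L M β U μ n) n →
      (∀ j ≤ n, (KernelNormsLevels L M P (klEngQ9dG klEngGeo14 P R) β U μ (klFlowFrameU L M β U μ n) j ∧
      KernelNormsWt4 L M (klWtBudget P (klEngQ9dG klEngGeo14 P R) U j) β U μ (klFlowFrameU L M β U μ n) j)) →
      (∀ j ≤ n, LevelsUExportMixedAt L M (klCU2 P R (klEngQ7 P R)) P β U μ j) →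
      (∀ n' ≤ n, ∀ (L₁ M₁ : ℕ) [NeZero L₁] [NeZero M₁], L ≤ L₁ → (klEngQ9dG klEngGeo14 P R).M0 β L₁ ≤ M₁ →
      (∀ j < n', histV17F2 L₁ M₁ klEngGeo14 P (klEngQ9dG klEngGeo14 P R) R β U μ j ∧ TwoLegSlopes L₁ M₁ R β U μ (klFlowFrameU L₁ M₁ β U μ j) j) →
      TwoLegGridMomentsAtC L₁ M₁ (klZtG klEngGeo14 P R) (klZs1G klEngGeo14 P R) (klZs2G klEngGeo14 P R) c β U μ (klFlowFrameU L₁ M₁ β U μ n') n') →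
      TwoLegStepV17F2 L M klEngGeo14 P (klEngQ9dG klEngGeo14 P R) R β U μ n)
    :

    ∃ G : GeoConsts, G.WF ∧ ∀ P : SplitConsts, P.WF → ∀ R : RenConsts, R.WF2 → ∃ Q : EngConsts, Q.WF ∧ ∃ c₃ : ℝ, 0 < c₃ ∧
      ∃ c'' : ℝ, 0 ≤ c'' ∧ ∀ c : ℝ, 0 < c → c ≤ c₃ →
        ∃ U₀ : ℝ, 0 < U₀ ∧ ∃ L₃ : ℝ → ℝ → ℕ, ∃ M₃ : ℝ → ℝ → ℕ → ℕ,
          ∀ μ ∈ klWindowC, ∀ U : ℝ, 0 < U → U ≤ U₀ → ∀ β : ℝ, klBetaMin ≤ β → β ≤ Real.exp (c / U ^ 2) →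
            ∀ K : TrigPolyC4v, klPredsV17F2.frameOK R U (nScales β) μ K →
              ∀ (L M : ℕ) [NeZero L] [NeZero M], L₃ β U ≤ L → M₃ β U L ≤ M →
                ∀ n : ℕ, n ≤ nScales β + 1 → IsKLRegime U c (-(n : ℤ)) → HistP klPredsV17F2 L M G P Q R β U μ K n →
                  (klPredsV17F2.engine L M G P Q β U μ K n ∧ klPredsV17F2.twoLeg L M G P Q R β U μ K n) ∧
                    ∀ m : ℕ, 1 ≤ m → m < n → FlowPieceOscAt L M c'' β U μ m := by
  refine ⟨klEngGeo14, klEngGeo14_wf, fun P hP R hR => ⟨klEngQ9dG klEngGeo14 P R, klEngQ9dG_wf klEngGeo14 P R, klEngC₃7GU klEngGeo14 P R,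
    klEngC₃7GU_pos klEngGeo14 P hR, klReadOscC P R, klReadOscC_nonneg P R, fun c hc hc3 => ?_⟩⟩
  refine ⟨klEngU₀12GQ klEngGeo14 (klEngQ9dG klEngGeo14 P R) P R c,
    klEngU₀12GQ_pos (klEngQ9dG klEngGeo14 P R) P c klEngGeo14_wf hP hR (klEngQ9dG_CR_nonneg klEngGeo14 P R), klEngL₄ P R, klEngM₃, ?_⟩
  intro μ hμ U hU hUle β hβ hβc K hK L M _ _ hL hM n hn hreg hhist
  obtain ⟨rfl, -⟩ := (klPredsV17F2_frameOK_iff R U (nScales β) μ K).1 hK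
  exact ⟨engine_slots_of_rows rowC rowX rowB rowV rowE P R c hP hR hc hc3 μ hμ U hU hUle β hβ hβc L M hL hM hn hreg hhist,
    flowPieceOsc_hist_of_rows rowC rowX P R c hP hR hc hc3 μ hμ U hU hUle β hβ hβc L M hL hM hn hhist⟩

set_option maxRecDepth 8192 in
set_option maxHeartbeats 3200000 in -- long binder lists
/-- **THE VL (K5′) ATOM `stub_vl_flowPieceOscTE` (text 398b3e3a086b) FROM THE FIVE REGISTERED ENGINE ROWS**, by `hoscTAtom_of_engineOsc`.
[cite: BenfattoGiulianiMastropietro2006, §2.4 (2.36)–(2.42)] -/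
theorem vlFlowPieceOscTE_of_rows
    (rowC :
      ∀ (P : SplitConsts) (R : RenConsts) (c : ℝ), P.WF → R.WF2 → 0 < c → c ≤ klEngC₃7GU klEngGeo14 P R →
      ∀ μ ∈ klWindowC, ∀ U : ℝ, 0 < U → U ≤ klEngU₀12GQ klEngGeo14 (klEngQ9dG klEngGeo14 P R) P R c → ∀ β : ℝ, klBetaMin ≤ β → β ≤ Real.exp (c / U ^ 2) →
      ∀ (L M : ℕ) [NeZero L] [NeZero M], klEngL₄ P R β U ≤ L → klEngM₃ β U L ≤ M → ∀ n : ℕ, n ≤ nScales β + 1 → IsKLRegime U c (-(n : ℤ)) →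
      HistP klPredsV17F2 L M klEngGeo14 P (klEngQ9dG klEngGeo14 P R) R β U μ 0 n → FrameOK R U (nScales β) μ (klFlowFrameU L M β U μ n) →
      EngineBoundsAtV17F2 L M klEngGeo14 P (klEngQ9dG klEngGeo14 P R) β U μ n → TwoLegDualSpaceMomentsUpToAt L M (klZsp5AtZ P R (klEngQ7 P R) klEngGeo14 U n) β U μ n 5 →
      TwoLegReadJetBound L M klC4aJetC2 (klC4aJetC' P R) β U μ (klFlowFrameU L M β U μ n) n ∧ TwoLegReadOscAt L M (klReadOscC P R) β U μ (klFlowFrameU L M β U μ n) n)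
    (rowX :
      ∀ (P : SplitConsts) (R : RenConsts), P.WF → R.WF2 → (∃ e : (ℕ → ℝ) × ℝ × (EngConsts → ℝ → ℝ), IsExportPkg2 e ∧ LevelsUStep2 P R (klEngQ7 P R) e.1 e.2.2) ∧
      (∃ e : ℝ × (EngConsts → ℝ → ℝ), IsTransferPkg8 e ∧ PairTransferStep7 P R (klEngQ7 P R) klEngGeo14 klEngGeoTh e.1 e.2) ∧
      (∃ e : (ℕ → ℝ) × (EngConsts → ℝ → ℝ), IsSpaceMomPkg5Z R e ∧ TwoLegSpaceMomentsStep5 P R (klEngQ7 P R) klEngGeo14 e.1 e.2))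
    (rowB :
      ∀ (P : SplitConsts) (R : RenConsts) (c : ℝ), P.WF → R.WF2 → 0 < c → c ≤ klEngC₃7GU klEngGeo14 P R →
      ∀ μ ∈ klWindowC, ∀ U : ℝ, 0 < U → U ≤ klEngU₀12GQ klEngGeo14 (klEngQ9dG klEngGeo14 P R) P R c → ∀ β : ℝ, klBetaMin ≤ β → β ≤ Real.exp (c / U ^ 2) →
      ∀ (L M : ℕ) [NeZero L] [NeZero M], klEngL₄ P R β U ≤ L → klEngM₃ β U L ≤ M → ∀ n : ℕ, 1 ≤ n → n ≤ nScales β + 1 → IsKLRegime U c (-(n : ℤ)) →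
      HistP klPredsV17F2 L M klEngGeo14 P (klEngQ9dG klEngGeo14 P R) R β U μ 0 n → (∀ m, 1 ≤ m → m < n → FlowPieceOscAt L M (klReadOscC P R) β U μ m) →
      FrameOK R U (nScales β) μ (klFlowFrameU L M β U μ n) → (∀ j ≤ n, LevelsUExportMixedAt L M (klCU2 P R (klEngQ7 P R)) P β U μ j) →
      KernelNormsV4 L M P (klEngQ9dG klEngGeo14 P R) β U μ (klFlowFrameU L M β U μ n) n ∧
      (∀ j ≤ n, (KernelNormsLevels L M P (klEngQ9dG klEngGeo14 P R) β U μ (klFlowFrameU L M β U μ n) j ∧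
      KernelNormsWt4 L M (klWtBudget P (klEngQ9dG klEngGeo14 P R) U j) β U μ (klFlowFrameU L M β U μ n) j)) ∧
      EngineFirstMoments L M klEngGeo14 P (klEngQ9dG klEngGeo14 P R) β U μ (klFlowFrameU L M β U μ n) n ∧ IsoFirstMomentsAt L M klIsoMomC (klIsoMomD P R) P β U μ n ∧
      TwoLegGridFlowMomentsAtC L M (klZtG klEngGeo14 P R) (klZs1G klEngGeo14 P R) (klZs2G klEngGeo14 P R) c β U μ n)
    (rowV :
      ∀ (P : SplitConsts) (R : RenConsts) (c : ℝ), P.WF → R.WF2 → 0 < c → c ≤ klEngC₃7GU klEngGeo14 P R →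
      ∀ μ ∈ klWindowC, ∀ U : ℝ, 0 < U → U ≤ klEngU₀12GQ klEngGeo14 (klEngQ9dG klEngGeo14 P R) P R c → ∀ β : ℝ, klBetaMin ≤ β → β ≤ Real.exp (c / U ^ 2) →
      ∀ (L M : ℕ) [NeZero L] [NeZero M], klEngL₄ P R β U ≤ L → klEngM₃ β U L ≤ M → ∀ n : ℕ, 1 ≤ n → n ≤ nScales β + 1 → IsKLRegime U c (-(n : ℤ)) →
      HistP klPredsV17F2 L M klEngGeo14 P (klEngQ9dG klEngGeo14 P R) R β U μ 0 n → FrameOK R U (nScales β) μ (klFlowFrameU L M β U μ n) →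
      KernelNormsV4 L M P (klEngQ9dG klEngGeo14 P R) β U μ (klFlowFrameU L M β U μ n) n →
      (∀ j ≤ n, (KernelNormsLevels L M P (klEngQ9dG klEngGeo14 P R) β U μ (klFlowFrameU L M β U μ n) j ∧
      KernelNormsWt4 L M (klWtBudget P (klEngQ9dG klEngGeo14 P R) U j) β U μ (klFlowFrameU L M β U μ n) j)) →
      (∀ j ≤ n, LevelsUExportMixedAt L M (klCU2 P R (klEngQ7 P R)) P β U μ j) → (∀ j ≤ n, IsoTupleLineBAt L M klE5AM klE5cM (klE5dM P R) P β U μ j) →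
      (∀ j ≤ n, PairTransferRelFamilyK5 L M klEngGeoTh P (klCT8 P R (klEngQ7 P R) klEngGeo14 klEngGeoTh) β U μ j) →
      PairLadderStepAtV17F2 L M klEngGeo14 P (klEngQ9dG klEngGeo14 P R) β U μ n ∧ PairValueIncrementAtV17F L M klEngGeo14 P (klEngQ9dG klEngGeo14 P R) β U μ n ∧
      QuarticValueIncrementAtV17F L M klEngGeo14 P (klEngQ9dG klEngGeo14 P R) β U μ n ∧ IsoTupleL1AtV17F L M klEngGeo14 P β U μ n)
    (rowE :
      ∀ (P : SplitConsts) (R : RenConsts) (c : ℝ), P.WF → R.WF2 → 0 < c → c ≤ klEngC₃7GU klEngGeo14 P R →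
      ∀ μ ∈ klWindowC, ∀ U : ℝ, 0 < U → U ≤ klEngU₀12GQ klEngGeo14 (klEngQ9dG klEngGeo14 P R) P R c → ∀ β : ℝ, klBetaMin ≤ β → β ≤ Real.exp (c / U ^ 2) →
      ∀ (L M : ℕ) [NeZero L] [NeZero M], klEngL₄ P R β U ≤ L → klEngM₃ β U L ≤ M → ∀ n : ℕ, 1 ≤ n → n ≤ nScales β + 1 → IsKLRegime U c (-(n : ℤ)) →
      HistP klPredsV17F2 L M klEngGeo14 P (klEngQ9dG klEngGeo14 P R) R β U μ 0 n → FrameOK R U (nScales β) μ (klFlowFrameU L M β U μ n) →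
      EngineBoundsAtV17F2 L M klEngGeo14 P (klEngQ9dG klEngGeo14 P R) β U μ n → TwoLegReadJetBound L M klC4aJetC2 (klC4aJetC' P R) β U μ (klFlowFrameU L M β U μ n) n →
      (∀ j ≤ n, (KernelNormsLevels L M P (klEngQ9dG klEngGeo14 P R) β U μ (klFlowFrameU L M β U μ n) j ∧
      KernelNormsWt4 L M (klWtBudget P (klEngQ9dG klEngGeo14 P R) U j) β U μ (klFlowFrameU L M β U μ n) j)) →
      (∀ j ≤ n, LevelsUExportMixedAt L M (klCU2 P R (klEngQ7 P R)) P β U μ j) →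
      (∀ n' ≤ n, ∀ (L₁ M₁ : ℕ) [NeZero L₁] [NeZero M₁], L ≤ L₁ → (klEngQ9dG klEngGeo14 P R).M0 β L₁ ≤ M₁ →
      (∀ j < n', histV17F2 L₁ M₁ klEngGeo14 P (klEngQ9dG klEngGeo14 P R) R β U μ j ∧ TwoLegSlopes L₁ M₁ R β U μ (klFlowFrameU L₁ M₁ β U μ j) j) →
      TwoLegGridMomentsAtC L₁ M₁ (klZtG klEngGeo14 P R) (klZs1G klEngGeo14 P R) (klZs2G klEngGeo14 P R) c β U μ (klFlowFrameU L₁ M₁ β U μ n') n') →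
      TwoLegStepV17F2 L M klEngGeo14 P (klEngQ9dG klEngGeo14 P R) R β U μ n)
    :

    ∀ (G : GeoConsts) (P : SplitConsts) (Q : EngConsts) (R : RenConsts), P.WF → R.WF2 →
      ∃ c'' : ℝ, 0 ≤ c'' ∧ ∃ c₇ : ℝ, 0 < c₇ ∧ ∀ c : ℝ, 0 < c → c ≤ c₇ → ∃ U₇ : ℝ, 0 < U₇ ∧
        ∀ μ ∈ klWindowC, ∀ U : ℝ, 0 < U → U ≤ U₇ → ∀ β : ℝ, klBetaMin ≤ β → β ≤ Real.exp (c / U ^ 2) →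
          ∀ (K : TrigPolyC4v) (Lstar : ℕ) (Mstar : ℕ → ℕ), TowerP klPredsV17F2 G P Q R β U μ K Lstar Mstar →
          ∃ L₂ : ℕ, ∃ M₂ : ℕ → ℕ, ∀ (L M : ℕ) [NeZero L] [NeZero M], L₂ ≤ L → M₂ L ≤ M →
            ∀ m : ℕ, 1 ≤ m → m < nScales β + 1 → FlowPieceOscAt L M c'' β U μ m :=
  hoscTAtom_of_engineOsc (engineP4Osc_klPredsV17F2_of_rows rowC rowX rowB rowV rowE)

end Summit.HubbardSuperconductivity.HubbardSuperconductivity.Theorems.EngineV8.R16V2Rows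

end
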